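import Summits.Parity.GeneralizedHardyLittlewood.Theses.GoldbachHeathBrownDispersion
import Literature.NumberTheory.Sieve.HeathBrownCubicPrimesProofs
import HarnessLib

/-!
# Route `GoldbachHeathBrownDispersion` — crux `HeathBrownMorozUniform` (stmt-Parity-19915): the reduction layer

Helper file (`--supports stmt-Parity-19915`) for the crux
`Summit.Parity.GeneralizedHardyLittlewood.Theses.GoldbachHeathBrownDispersion.HeathBrownMorozUniform`
(Heath-Brown–Moroz 2004, Theorem 2 for `x³ + 2y³`, finite-uniform form: for every `Q` ONE box exponent `c`
serving all admissible classes `(a, b) mod d`, `d ≤ Q`).  Elementary and independent of the coset port of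
Heath-Brown's proof; it is what every line of attack on the crux needs at the end:
* `isLittleO_eta_mul_self_mainTerm`, `isLittleO_const_mainTerm`, `isLittleO_linear_mainTerm`: `ηX = o(M)`,
  `1 = o(M)` for `η = (log X)^{-c}`, `M = σ₀η²X²/(3 log X)` (`mainTerm`);
* `abs_residueClassPrimeCount_shift_sub_le` — **box-shift lemma**: the representative `(a + dk₁, b + dk₂)`
  translates the counted box by `(k₁, k₂)`; the counts differ by `≤ (k₁ + k₂)(ηX + 1)` (two thin slabs);
  hence `classAsymp_shift` / `classAsymp_of_shift` / `classAsymp_iff_mod` (representative invariance);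
* `heathBrownMorozUniform_iff_reduced` — the crux ⇔ its restriction to reduced representatives `a, b < d`;
* `heathBrownMorozUniform_of_allLargeC` — **finite max**: per reduced admissible class a threshold `c₁`
  with the class asymptotic for EVERY `c ≥ c₁` (the shape Heath-Brown's argument yields) ⇒ the crux
  (`c_Q = 1 + ∑ c₁`, `σ₀` unique by `tendsto_nhds_unique`);
* `heathBrownMorozUniform_le_one` — the cases `Q ≤ 1` from the tree's `HeathBrown2001_primePairCount_asymptotic_holds`.

References: D. R. Heath-Brown, B. Z. Moroz, Proc. LMS (3) 88 (2004) 289–312, Theorem 2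
[cite: HeathBrownMoroz2004, Theorem 2]; D. R. Heath-Brown, Acta Math. 186 (2001) 1–84, Theorem 1 / (2.2)
[cite: HeathBrownActa2001, Theorem 1].  Tree search: `residueClassPrimePairs`, `mem_residueClassPrimePairs_iff`,
`residueClassPrimeCount_one_zero_zero`, `classWeight_one`, `mainTerm_pos`, `mainTerm_mul_loglog_isLittleO`,
`HeathBrown2001_singularProduct_holds`; Mathlib `isLittleO_log_rpow_rpow_atTop`, `isLittleO_iff_tendsto'`,
`Nat.floor_add_natCast`, `Finset.card_filter_add_card_filter_not`.
-/

noncomputable section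

open Filter Asymptotics Finset Topology

namespace Summit.Parity.GeneralizedHardyLittlewood.Theorems.GoldbachHeathBrownDispersionHeathBrownMorozUniform

open Literature.NumberTheory.Sieve.CubicPrimes

/-! ### Size comparisons against the main term -/

/-- `ηX = o(σ₀η²X²/(3 log X))` for `η = (log X)^{-c}`, `c > 0`, `σ₀ > 0`: the ratio is
`3(log X)^{1+c}/(σ₀X) → 0`. [folklore] -/
theorem isLittleO_eta_mul_self_mainTerm (c : ℝ) {σ₀ : ℝ} (hσ₀ : 0 < σ₀) :
    (fun X : ℝ => Real.log X ^ (-c) * X) =o[atTop] fun X => mainTerm c σ₀ X := by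
  refine (isLittleO_iff_tendsto' ?_).2 ?_
  · filter_upwards [eventually_gt_atTop (1 : ℝ)] with X hX h
    exact absurd h (mainTerm_pos hσ₀ hX).ne'
  · have h1 : (fun X : ℝ => Real.log X ^ (1 + c)) =o[atTop] fun X => X ^ (1 : ℝ) :=
      isLittleO_log_rpow_rpow_atTop (1 + c) one_pos
    have h3 : Tendsto (fun X : ℝ => 3 / σ₀ * (Real.log X ^ (1 + c) / X ^ (1 : ℝ))) atTop (𝓝 0) := by
      simpa using h1.tendsto_div_nhds_zero.const_mul (3 / σ₀)
    refine h3.congr' ?_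
    filter_upwards [eventually_gt_atTop (1 : ℝ)] with X hX
    have hL : 0 < Real.log X := Real.log_pos hX
    have hX0 : 0 < X := by linarith
    have hLc : 0 < Real.log X ^ c := Real.rpow_pos_of_pos hL c
    rw [Real.rpow_one, mainTerm, Real.rpow_add hL, Real.rpow_one, Real.rpow_neg hL.le]
    field_simp

/-- `1 = o(σ₀η²X²/(3 log X))` for `η = (log X)^{-c}`: the ratio is `3(log X)^{1+2c}/(σ₀X²) → 0`.
[folklore] -/
theorem isLittleO_const_mainTerm (c : ℝ) {σ₀ : ℝ} (hσ₀ : 0 < σ₀) :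
    (fun _ : ℝ => (1 : ℝ)) =o[atTop] fun X => mainTerm c σ₀ X := by
  refine (isLittleO_iff_tendsto' ?_).2 ?_
  · filter_upwards [eventually_gt_atTop (1 : ℝ)] with X hX h
    exact absurd h (mainTerm_pos hσ₀ hX).ne'
  · have h1 : (fun X : ℝ => Real.log X ^ (1 + 2 * c)) =o[atTop] fun X => X ^ (2 : ℝ) :=
      isLittleO_log_rpow_rpow_atTop (1 + 2 * c) two_pos
    have h3 : Tendsto (fun X : ℝ => 3 / σ₀ * (Real.log X ^ (1 + 2 * c) / X ^ (2 : ℝ))) atTop (𝓝 0) := by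
      simpa using h1.tendsto_div_nhds_zero.const_mul (3 / σ₀)
    refine h3.congr' ?_
    filter_upwards [eventually_gt_atTop (1 : ℝ)] with X hX
    have hL : 0 < Real.log X := Real.log_pos hX
    have hX0 : 0 < X := by linarith
    have hLc : 0 < Real.log X ^ c := Real.rpow_pos_of_pos hL c
    have h2c : Real.log X ^ (1 + 2 * c) = Real.log X * (Real.log X ^ c) ^ 2 := by
      rw [Real.rpow_add hL, Real.rpow_one, mul_comm (2 : ℝ) c, Real.rpow_mul hL.le, Real.rpow_two]
    rw [Real.rpow_two, mainTerm, h2c, Real.rpow_neg hL.le]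
    field_simp

/-- Any `A·ηX + B` is `o(σ₀η²X²/(3 log X))`. [folklore] -/
theorem isLittleO_linear_mainTerm (c : ℝ) {σ₀ : ℝ} (hσ₀ : 0 < σ₀) (A B : ℝ) :
    (fun X : ℝ => A * (Real.log X ^ (-c) * X) + B) =o[atTop] fun X => mainTerm c σ₀ X := by
  have h1 := (isLittleO_eta_mul_self_mainTerm c hσ₀).const_mul_left A
  have h2 := (isLittleO_const_mainTerm c hσ₀).const_mul_left B
  simpa using h1.add h2

/-! ### The box-shift lemma -/

/-- The number of integers in `(X, X(1+η)]` is at most `ηX + 1` (`X, η ≥ 0`). [folklore] -/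
theorem card_Ioc_floor_le {X η : ℝ} (hX : 0 ≤ X) (hη : 0 ≤ η) :
    ((⌊X * (1 + η)⌋₊ - ⌊X⌋₊ : ℕ) : ℝ) ≤ η * X + 1 := by
  have hmono : ⌊X⌋₊ ≤ ⌊X * (1 + η)⌋₊ := Nat.floor_le_floor (by nlinarith)
  rw [Nat.cast_sub hmono]
  have h1 : (⌊X * (1 + η)⌋₊ : ℝ) ≤ X * (1 + η) := Nat.floor_le (by positivity)
  have h2 : X < ⌊X⌋₊ + 1 := Nat.lt_floor_add_one X
  linarith

/-- **Box-shift lemma.** Replacing the representative `(a, b)` of a class modulo `d` by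
`(a + dk₁, b + dk₂)` translates the counted box `(X, X(1+η)]²` by `(k₁, k₂)`; the two counts differ by
at most the number of lattice points in two slabs of widths `k₁`, `k₂` and length `≤ ηX + 1`:
`|π(class, a + dk₁, b + dk₂) − π(class, a, b)| ≤ (k₁ + k₂)(ηX + 1)`. [folklore] -/
theorem abs_residueClassPrimeCount_shift_sub_le {X η : ℝ} (hX : 0 ≤ X) (hη : 0 ≤ η)
    (d a b k₁ k₂ : ℕ) :
    |(residueClassPrimeCount X η d (a + d * k₁) (b + d * k₂) : ℝ) - residueClassPrimeCount X η d a b| ≤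
      ((k₁ : ℝ) + k₂) * (η * X + 1) := by
  classical
  set S₀ := residueClassPrimePairs X η d a b with hS₀
  set S₁ := residueClassPrimePairs X η d (a + d * k₁) (b + d * k₂) with hS₁
  set m := ⌊X⌋₊ with hm
  set M := ⌊X * (1 + η)⌋₊ with hM
  set N : ℕ := M - m with hN
  have hNle : (N : ℝ) ≤ η * X + 1 := card_Ioc_floor_le hX hη
  -- the translation `t (x₁, x₂) = (x₁ + k₁, x₂ + k₂)`
  let t : ℕ × ℕ ↪ ℕ × ℕ :=
    ⟨fun x => (x.1 + k₁, x.2 + k₂), fun x y h => by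
      simp only [Prod.mk.injEq, add_left_inj] at h
      exact Prod.ext h.1 h.2⟩
  set T := S₁.map t with hT
  have hTcard : #T = #S₁ := card_map _
  set I := S₀.filter (fun y : ℕ × ℕ => X + k₁ < (y.1 : ℝ) ∧ X + k₂ < (y.2 : ℝ)) with hI
  set E₀ : Finset (ℕ × ℕ) := (Ioc m (m + k₁) ×ˢ Ioc m M) ∪ (Ioc m M ×ˢ Ioc m (m + k₂)) with hE₀
  set E₁ : Finset (ℕ × ℕ) := (Ioc M (M + k₁) ×ˢ Ioc (m + k₂) (M + k₂)) ∪
      (Ioc (m + k₁) (M + k₁) ×ˢ Ioc M (M + k₂)) with hE₁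
  have hE₀card : (#E₀ : ℝ) ≤ ((k₁ : ℝ) + k₂) * (η * X + 1) := by
    have h := card_union_le (Ioc m (m + k₁) ×ˢ Ioc m M) (Ioc m M ×ˢ Ioc m (m + k₂))
    rw [card_product, card_product, Nat.card_Ioc, Nat.card_Ioc, Nat.card_Ioc] at h
    have h' : (#E₀ : ℝ) ≤ (k₁ : ℝ) * N + N * k₂ := by
      rw [hE₀]; simp only [hN]
      have := h; simp only [Nat.add_sub_cancel_left] at this
      exact_mod_cast this
    nlinarith [(Nat.cast_nonneg k₁ : (0:ℝ) ≤ k₁), (Nat.cast_nonneg k₂ : (0:ℝ) ≤ k₂)]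
  have hE₁card : (#E₁ : ℝ) ≤ ((k₁ : ℝ) + k₂) * (η * X + 1) := by
    have h := card_union_le (Ioc M (M + k₁) ×ˢ Ioc (m + k₂) (M + k₂))
      (Ioc (m + k₁) (M + k₁) ×ˢ Ioc M (M + k₂))
    rw [card_product, card_product, Nat.card_Ioc, Nat.card_Ioc, Nat.card_Ioc, Nat.card_Ioc] at h
    have e1 : M + k₂ - (m + k₂) = N := by rw [hN]; omega
    have e2 : M + k₁ - (m + k₁) = N := by rw [hN]; omega
    rw [e1, e2, Nat.add_sub_cancel_left, Nat.add_sub_cancel_left] at h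
    have h' : (#E₁ : ℝ) ≤ (k₁ : ℝ) * N + N * k₂ := by rw [hE₁]; exact_mod_cast h
    nlinarith [(Nat.cast_nonneg k₁ : (0:ℝ) ≤ k₁), (Nat.cast_nonneg k₂ : (0:ℝ) ≤ k₂)]
  have hm_lt : ∀ {y : ℕ}, X < (y : ℝ) → m < y := fun h => (Nat.floor_lt hX).2 h
  have hle_M : ∀ {y : ℕ}, (y : ℝ) ≤ X * (1 + η) → y ≤ M := fun h => Nat.le_floor h
  have hXη : 0 ≤ X * (1 + η) := by positivity
  -- (1) `#S₀ ≤ #I + #E₀`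
  have h1 : #S₀ ≤ #I + #E₀ := by
    rw [hI, ← card_filter_add_card_filter_not
      (fun y : ℕ × ℕ => X + k₁ < (y.1 : ℝ) ∧ X + k₂ < (y.2 : ℝ))]
    refine Nat.add_le_add_left (card_le_card ?_) _
    intro y hy
    rw [mem_filter] at hy
    obtain ⟨hyS, hneg⟩ := hy
    obtain ⟨y₁, y₂⟩ := y
    obtain ⟨hx1, hx2, hy1, hy2, -, -⟩ := mem_residueClassPrimePairs_iff.1 hyS
    rw [hE₀, mem_union, mem_product, mem_product, mem_Ioc, mem_Ioc, mem_Ioc, mem_Ioc]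
    simp only [not_and_or, not_lt] at hneg
    rcases hneg with h | h
    · left
      refine ⟨⟨hm_lt hx1, ?_⟩, hm_lt hy1, hle_M hy2⟩
      have : (y₁ : ℝ) ≤ ⌊X + k₁⌋₊ := by
        have := Nat.le_floor (α := ℝ) (n := y₁) (a := X + k₁) h
        exact_mod_cast this
      rw [Nat.floor_add_natCast hX] at this
      exact_mod_cast this
    · right
      refine ⟨⟨hm_lt hx1, hle_M hx2⟩, hm_lt hy1, ?_⟩
      have : (y₂ : ℝ) ≤ ⌊X + k₂⌋₊ := by
        have := Nat.le_floor (α := ℝ) (n := y₂) (a := X + k₂) h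
        exact_mod_cast this
      rw [Nat.floor_add_natCast hX] at this
      exact_mod_cast this
  -- (2) `I ⊆ T`, so `#I ≤ #S₁`
  have h2 : #I ≤ #S₁ := by
    rw [← hTcard]
    refine card_le_card fun y hy => ?_
    rw [hI, mem_filter] at hy
    obtain ⟨hyS, hk1, hk2⟩ := hy
    obtain ⟨y₁, y₂⟩ := y
    obtain ⟨hx1, hx2, hy1, hy2, hcop, hpr⟩ := mem_residueClassPrimePairs_iff.1 hyS
    have hk1' : k₁ ≤ y₁ := by
      have : (k₁ : ℝ) < y₁ := by linarith
      exact_mod_cast this.le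
    have hk2' : k₂ ≤ y₂ := by
      have : (k₂ : ℝ) < y₂ := by linarith
      exact_mod_cast this.le
    rw [hT, Finset.mem_map]
    refine ⟨(y₁ - k₁, y₂ - k₂), ?_, ?_⟩
    · rw [hS₁]
      apply mem_residueClassPrimePairs_iff.2
      have e1 : a + d * k₁ + d * (y₁ - k₁) = a + d * y₁ := by
        zify [hk1']; ring
      have e2 : b + d * k₂ + d * (y₂ - k₂) = b + d * y₂ := by
        zify [hk2']; ring
      rw [e1, e2, Nat.cast_sub hk1', Nat.cast_sub hk2']
      exact ⟨by linarith, by linarith, by linarith, by linarith, hcop, hpr⟩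
    · simp only [t, Function.Embedding.coeFn_mk, Nat.sub_add_cancel hk1', Nat.sub_add_cancel hk2']
  -- (3) `T ⊆ I ∪ E₁`, so `#S₁ ≤ #I + #E₁`
  have h3 : #S₁ ≤ #I + #E₁ := by
    rw [← hTcard]
    refine (card_le_card fun y hy => ?_).trans (card_union_le _ _)
    rw [hT, Finset.mem_map] at hy
    obtain ⟨⟨x₁, x₂⟩, hx, rfl⟩ := hy
    rw [hS₁] at hx
    obtain ⟨hx1, hx2, hy1, hy2, hcop, hpr⟩ := mem_residueClassPrimePairs_iff.1 hx
    have e1 : a + d * k₁ + d * x₁ = a + d * (x₁ + k₁) := by ring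
    have e2 : b + d * k₂ + d * x₂ = b + d * (x₂ + k₂) := by ring
    rw [e1, e2] at hcop hpr
    simp only [t, Function.Embedding.coeFn_mk]
    rw [mem_union]
    by_cases hc1 : ((x₁ + k₁ : ℕ) : ℝ) ≤ X * (1 + η)
    · by_cases hc2 : ((x₂ + k₂ : ℕ) : ℝ) ≤ X * (1 + η)
      · left
        rw [hI, mem_filter, hS₀]
        refine ⟨mem_residueClassPrimePairs_iff.2 ⟨?_, hc1, ?_, hc2, hcop, hpr⟩, ?_, ?_⟩
        · push_cast; linarith
        · push_cast; linarith
        · push_cast; linarith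
        · push_cast; linarith
      · right
        rw [hE₁, mem_union]; right
        rw [mem_product, mem_Ioc, mem_Ioc]
        push Not at hc2
        refine ⟨⟨?_, ?_⟩, ?_, ?_⟩
        · have : m + k₁ < x₁ + k₁ := Nat.add_lt_add_right (hm_lt hx1) _
          exact this
        · exact Nat.add_le_add_right (hle_M hx2) _
        · exact (Nat.floor_lt hXη).2 hc2
        · have := hle_M hy2; omega
    · right
      rw [hE₁, mem_union]; left
      rw [mem_product, mem_Ioc, mem_Ioc]
      push Not at hc1
      refine ⟨⟨(Nat.floor_lt hXη).2 hc1, ?_⟩, ?_, ?_⟩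
      · have := hle_M hx2; omega
      · exact Nat.add_lt_add_right (hm_lt hy1) _
      · exact Nat.add_le_add_right (hle_M hy2) _
  -- (4) `#I ≤ #S₀`
  have h4 : #I ≤ #S₀ := by rw [hI]; exact card_filter_le _ _
  rw [residueClassPrimeCount_def, residueClassPrimeCount_def, ← hS₀, ← hS₁]
  have h1' : (#S₀ : ℝ) ≤ #I + #E₀ := by exact_mod_cast h1
  have h2' : (#I : ℝ) ≤ #S₁ := by exact_mod_cast h2
  have h3' : (#S₁ : ℝ) ≤ #I + #E₁ := by exact_mod_cast h3
  have h4' : (#I : ℝ) ≤ #S₀ := by exact_mod_cast h4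
  rw [abs_le]
  constructor <;> linarith

/-! ### The class asymptotic does not depend on the representative -/

/-- The difference of the two class counts under a shift of representative is `o(M)`. [folklore] -/
theorem isLittleO_residueClassPrimeCount_shift_sub (c : ℝ) {σ₀ : ℝ} (hσ₀ : 0 < σ₀) (d a b k₁ k₂ : ℕ) :
    (fun X : ℝ => (residueClassPrimeCount X (Real.log X ^ (-c)) d (a + d * k₁) (b + d * k₂) : ℝ) -
        residueClassPrimeCount X (Real.log X ^ (-c)) d a b) =o[atTop] fun X => mainTerm c σ₀ X := by
  refine IsBigO.trans_isLittleO ?_ (isLittleO_linear_mainTerm c hσ₀ ((k₁ : ℝ) + k₂) ((k₁ : ℝ) + k₂))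
  refine IsBigO.of_bound 1 ?_
  filter_upwards [eventually_ge_atTop (1 : ℝ)] with X hX
  have hη : 0 ≤ Real.log X ^ (-c) := Real.rpow_nonneg (Real.log_nonneg hX) _
  have hb := abs_residueClassPrimeCount_shift_sub_le (zero_le_one.trans hX) hη d a b k₁ k₂
  have hpos : 0 ≤ ((k₁ : ℝ) + k₂) * (Real.log X ^ (-c) * X) + ((k₁ : ℝ) + k₂) := by positivity
  rw [Real.norm_eq_abs, one_mul, Real.norm_of_nonneg hpos]
  calc _ ≤ ((k₁ : ℝ) + k₂) * (Real.log X ^ (-c) * X + 1) := hb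
    _ = ((k₁ : ℝ) + k₂) * (Real.log X ^ (-c) * X) + ((k₁ : ℝ) + k₂) := by ring

/-- The class asymptotic `π(class box) − w(d)·M = o(M)` passes from `(a, b)` to `(a + dk₁, b + dk₂)`
(box-shift lemma + `ηX, 1 = o(M)`). [folklore] -/
theorem classAsymp_shift {c σ₀ : ℝ} (hσ₀ : 0 < σ₀) (d a b k₁ k₂ : ℕ)
    (h : (fun X : ℝ => (residueClassPrimeCount X (Real.log X ^ (-c)) d a b : ℝ) -
        classWeight d * mainTerm c σ₀ X) =o[atTop] fun X => mainTerm c σ₀ X) :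
    (fun X : ℝ => (residueClassPrimeCount X (Real.log X ^ (-c)) d (a + d * k₁) (b + d * k₂) : ℝ) -
        classWeight d * mainTerm c σ₀ X) =o[atTop] fun X => mainTerm c σ₀ X :=
  (h.add (isLittleO_residueClassPrimeCount_shift_sub c hσ₀ d a b k₁ k₂)).congr_left fun X => by ring

/-- Conversely, the class asymptotic passes from `(a + dk₁, b + dk₂)` back to `(a, b)`. [folklore] -/
theorem classAsymp_of_shift {c σ₀ : ℝ} (hσ₀ : 0 < σ₀) (d a b k₁ k₂ : ℕ)
    (h : (fun X : ℝ =>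
        (residueClassPrimeCount X (Real.log X ^ (-c)) d (a + d * k₁) (b + d * k₂) : ℝ) -
          classWeight d * mainTerm c σ₀ X) =o[atTop] fun X => mainTerm c σ₀ X) :
    (fun X : ℝ => (residueClassPrimeCount X (Real.log X ^ (-c)) d a b : ℝ) -
        classWeight d * mainTerm c σ₀ X) =o[atTop] fun X => mainTerm c σ₀ X :=
  (h.sub (isLittleO_residueClassPrimeCount_shift_sub c hσ₀ d a b k₁ k₂)).congr_left fun X => by ring

/-- Admissibility depends only on the class: `gcd((a mod d)³ + 2(b mod d)³, d) = gcd(a³ + 2b³, d)`.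
[folklore] -/
theorem coprime_mod_iff (d a b : ℕ) :
    Nat.Coprime ((a % d) ^ 3 + 2 * (b % d) ^ 3) d ↔ Nat.Coprime (a ^ 3 + 2 * b ^ 3) d := by
  have h : (a % d) ^ 3 + 2 * (b % d) ^ 3 ≡ a ^ 3 + 2 * b ^ 3 [MOD d] :=
    ((Nat.mod_modEq a d).pow 3).add (((Nat.mod_modEq b d).pow 3).mul_left 2)
  rw [Nat.Coprime, Nat.Coprime, h.gcd_eq]

/-- The class asymptotic for `(a, b)` is the one for the reduced representative `(a mod d, b mod d)`.
[folklore] -/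
theorem classAsymp_iff_mod {c σ₀ : ℝ} (hσ₀ : 0 < σ₀) (d a b : ℕ) :
    ((fun X : ℝ => (residueClassPrimeCount X (Real.log X ^ (-c)) d a b : ℝ) -
        classWeight d * mainTerm c σ₀ X) =o[atTop] fun X => mainTerm c σ₀ X) ↔
      ((fun X : ℝ => (residueClassPrimeCount X (Real.log X ^ (-c)) d (a % d) (b % d) : ℝ) -
        classWeight d * mainTerm c σ₀ X) =o[atTop] fun X => mainTerm c σ₀ X) := by
  have ha : a % d + d * (a / d) = a := Nat.mod_add_div a d
  have hb : b % d + d * (b / d) = b := Nat.mod_add_div b d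
  constructor
  · intro h
    refine classAsymp_of_shift hσ₀ d (a % d) (b % d) (a / d) (b / d) ?_
    rwa [ha, hb]
  · intro h
    have := classAsymp_shift hσ₀ d (a % d) (b % d) (a / d) (b / d) h
    rwa [ha, hb] at this

/-! ### The crux reduced to reduced representatives, and the finite max -/

/-- **The crux is equivalent to its restriction to reduced representatives `a, b < d`.** [folklore] -/
theorem heathBrownMorozUniform_iff_reduced :
    Summit.Parity.GeneralizedHardyLittlewood.Theses.GoldbachHeathBrownDispersion.HeathBrownMorozUniform ↔
      ∀ Q : ℕ, ∃ c : ℝ, 0 < c ∧ ∃ σ₀ : ℝ, 0 < σ₀ ∧ Tendsto singularProductPartial atTop (𝓝 σ₀) ∧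
        ∀ d a b : ℕ, 0 < d → d ≤ Q → a < d → b < d → Nat.Coprime (a ^ 3 + 2 * b ^ 3) d →
          (fun X : ℝ => (residueClassPrimeCount X (Real.log X ^ (-c)) d a b : ℝ) -
              classWeight d * mainTerm c σ₀ X) =o[atTop] fun X : ℝ => mainTerm c σ₀ X := by
  unfold Summit.Parity.GeneralizedHardyLittlewood.Theses.GoldbachHeathBrownDispersion.HeathBrownMorozUniform
  constructor
  · intro h Q
    obtain ⟨c, hc, σ₀, hσ₀, hlim, hcl⟩ := h Q
    exact ⟨c, hc, σ₀, hσ₀, hlim, fun d a b hd hdQ _ _ hab => hcl d a b hd hdQ hab⟩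
  · intro h Q
    obtain ⟨c, hc, σ₀, hσ₀, hlim, hcl⟩ := h Q
    refine ⟨c, hc, σ₀, hσ₀, hlim, fun d a b hd hdQ hab => ?_⟩
    rw [classAsymp_iff_mod hσ₀]
    exact hcl d (a % d) (b % d) hd hdQ (Nat.mod_lt a hd) (Nat.mod_lt b hd) ((coprime_mod_iff d a b).2 hab)

/-- **Finite max.** If every REDUCED admissible class `(a, b) mod d` admits a threshold `c₁ = c₁(d,a,b)`
such that the class asymptotic `π(class box, η = (log X)^{-c}) = w(d)·σ₀η²X²/(3 log X)·(1 + o(1))` holds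
for EVERY `c ≥ c₁` (what Heath-Brown's proof yields: all constraints on the box exponent are lower
bounds), then the crux `HeathBrownMorozUniform` holds: for each `Q` take `c_Q = 1 + ∑ c₁(d,a,b)` over the
finitely many reduced classes with `d ≤ Q`, and note that the limit `σ₀` of the singular product is
unique. [cite: HeathBrownMoroz2004, Theorem 2] -/
theorem heathBrownMorozUniform_of_allLargeC
    (h : ∀ d a b : ℕ, 0 < d → a < d → b < d → Nat.Coprime (a ^ 3 + 2 * b ^ 3) d →
      ∃ c₁ : ℝ, 0 < c₁ ∧ ∀ c : ℝ, c₁ ≤ c →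
        ∃ σ₀ : ℝ, 0 < σ₀ ∧ Tendsto singularProductPartial atTop (𝓝 σ₀) ∧
          ((fun X : ℝ => (residueClassPrimeCount X (Real.log X ^ (-c)) d a b : ℝ) -
              classWeight d * mainTerm c σ₀ X) =o[atTop] fun X : ℝ => mainTerm c σ₀ X)) :
    Summit.Parity.GeneralizedHardyLittlewood.Theses.GoldbachHeathBrownDispersion.HeathBrownMorozUniform := by
  classical
  rw [heathBrownMorozUniform_iff_reduced]
  intro Q
  obtain ⟨σ₀, hσ₀, hlim⟩ := HeathBrown2001_singularProduct_holds
  -- the thresholds as a total function on triples, `0` off the admissible reduced classes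
  let c₁ : ℕ × ℕ × ℕ → ℝ := fun t =>
    if ht : 0 < t.1 ∧ t.2.1 < t.1 ∧ t.2.2 < t.1 ∧ Nat.Coprime (t.2.1 ^ 3 + 2 * t.2.2 ^ 3) t.1 then
      (h t.1 t.2.1 t.2.2 ht.1 ht.2.1 ht.2.2.1 ht.2.2.2).choose else 0
  have hc₁_nonneg : ∀ t, 0 ≤ c₁ t := by
    intro t
    simp only [c₁]
    split_ifs with ht
    · exact (h t.1 t.2.1 t.2.2 ht.1 ht.2.1 ht.2.2.1 ht.2.2.2).choose_spec.1.le
    · exact le_rfl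
  set T : Finset (ℕ × ℕ × ℕ) := Icc 1 Q ×ˢ (range (Q + 1) ×ˢ range (Q + 1)) with hT
  set c : ℝ := 1 + ∑ t ∈ T, c₁ t with hc
  have hsum : 0 ≤ ∑ t ∈ T, c₁ t := sum_nonneg fun t _ => hc₁_nonneg t
  refine ⟨c, by linarith, σ₀, hσ₀, hlim, fun d a b hd hdQ ha hb hab => ?_⟩
  have hmem : (d, a, b) ∈ T := by
    simp only [hT, mem_product, mem_Icc, mem_range]
    exact ⟨⟨hd, hdQ⟩, by omega, by omega⟩
  have ht : 0 < d ∧ a < d ∧ b < d ∧ Nat.Coprime (a ^ 3 + 2 * b ^ 3) d := ⟨hd, ha, hb, hab⟩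
  have hspec := (h d a b hd ha hb hab).choose_spec
  have hle : (h d a b hd ha hb hab).choose ≤ c := by
    have h1 : c₁ (d, a, b) ≤ ∑ t ∈ T, c₁ t := single_le_sum (fun t _ => hc₁_nonneg t) hmem
    have h2 : c₁ (d, a, b) = (h d a b hd ha hb hab).choose := by
      simp only [c₁]
      rw [dif_pos ht]
    linarith
  obtain ⟨σ₁, -, hlim₁, hasymp⟩ := hspec.2 c hle
  obtain rfl : σ₁ = σ₀ := tendsto_nhds_unique hlim₁ hlim
  exact hasymp

/-! ### The cases `Q ≤ 1` from Heath-Brown's theorem (`d = 1`) -/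

/-- **The crux for `Q ≤ 1`**: for `d = 1` every class box is a translate of Heath-Brown's box, so the
tree's theorem `HeathBrown2001_primePairCount_asymptotic_holds` (with its own exponent `c`) and the
box-shift lemma give the class asymptotic for every `(a, b)` (`w(1) = 1`). [cite: HeathBrownActa2001, Theorem 1] -/
theorem heathBrownMorozUniform_le_one :
    ∀ Q : ℕ, Q ≤ 1 → ∃ c : ℝ, 0 < c ∧ ∃ σ₀ : ℝ, 0 < σ₀ ∧ Tendsto singularProductPartial atTop (𝓝 σ₀) ∧
      ∀ d a b : ℕ, 0 < d → d ≤ Q → Nat.Coprime (a ^ 3 + 2 * b ^ 3) d →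
        (fun X : ℝ => (residueClassPrimeCount X (Real.log X ^ (-c)) d a b : ℝ) -
            classWeight d * mainTerm c σ₀ X) =o[atTop] fun X : ℝ => mainTerm c σ₀ X := by
  intro Q hQ
  obtain ⟨c, hc, σ₀, hσ₀, hlim, hO⟩ := HeathBrown2001_primePairCount_asymptotic_holds
  refine ⟨c, hc, σ₀, hσ₀, hlim, fun d a b hd hdQ _ => ?_⟩
  obtain rfl : d = 1 := by omega
  have h0 : (fun X : ℝ => (residueClassPrimeCount X (Real.log X ^ (-c)) 1 0 0 : ℝ) -
      classWeight 1 * mainTerm c σ₀ X) =o[atTop] fun X : ℝ => mainTerm c σ₀ X := by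
    simpa only [residueClassPrimeCount_one_zero_zero, classWeight_one, one_mul] using
      hO.trans_isLittleO (mainTerm_mul_loglog_isLittleO c σ₀)
  simpa using classAsymp_shift hσ₀ 1 0 0 a b h0


end Summit.Parity.GeneralizedHardyLittlewood.Theorems.GoldbachHeathBrownDispersionHeathBrownMorozUniform

end
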